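import Summits.Schanuel.Schanuel.Theorems.ZilberEacParamBranchKernel
import Summits.Schanuel.Schanuel.Theorems.ZilberEacAlgebraicLogTranscendence
import HarnessLib

/-!
# The equimodular class, XLVIII: the logarithm of an algebraic branch is transcendental — zeros and
# poles along PARAMETRISED (Puiseux) branches

HONEST FRAMING.  Cell `pub-schanuel` (Zilber's Exponential-Algebraic Closedness, case ladder;
host summit Schanuel), seat 2, gen 25.  File XLIII proved: if the irreducible fibre curve `Q = 0`
has an UNRAMIFIED zero or pole, the logarithm of any analytic branch `ρ` (`ρ(z₀) ≠ 0`) is not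
algebraic over `ℂ(z)`.  Here the zero (pole) may be RAMIFIED, provided it is presented by an analytic
parametrisation: **`not_isAlgebraic_log_algebraicBranch_param`** — if `γ, η` are analytic at `0`,
`η(0) = 0`, `η ≢ 0`, `γ' ≠ 0` on a punctured neighbourhood of `0` (e.g. `γ(t) = a + t^e`) and
`Q(γ t, η t) = 0` near `0`, then the germ of `L` (`L' = ρ'/ρ`) is not algebraic over `ℂ[zGerm]`;
**`not_isAlgebraic_log_algebraicBranch_param_pole`** — the same with `Q(γ t, 1/η t) = 0` on a
punctured neighbourhood (`q₀ ≠ 0`).  Proof as in file XLIII, run in the parameter `t`: the relation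
`R` of file XLI is a multiple of `Q` (file XL), so `R(γ, η) ≡ 0`; `G(γ, η) ≢ 0` and
`∂_tQ(γ, η) ≢ 0` by the kernel lemma for the two-germ evaluation (file XLVII, `γ̂` transcendental);
the chain rule in `t` turns `R(γ, η) = 0` into `(F(γ,η)/G(γ,η))' = -M·η'/η`, impossible by the
residue obstruction (file XLII).  With the Newton–Puiseux step of file XLIX this decides, e.g., the
reciprocal quartic `x₀y₀⁴ + y₀² + x₀ = 0` (file L).  [folklore (Liouville), made concrete] (new in
this form); nothing here is specific to Schanuel's conjecture (neither used nor implied);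
Mantova–Masser's question (PLMS 2024 §1 p. 5) and EC(3,2) stay OPEN.
-/

noncomputable section

open Filter Topology Polynomial

set_option linter.dupNamespace false

namespace Summit.Schanuel.Schanuel.Theorems

/-- `Q ∤ ∂_t Q` for `Q` of positive `t`-degree (characteristic zero). [folklore] -/
theorem not_dvd_derivative_of_natDegree_ne_zero {Q : ℂ[X][X]} (hQ1 : Q.natDegree ≠ 0) :
    ¬ Q ∣ derivative Q := by
  intro h
  have hd0 : derivative Q ≠ 0 := fun h0 => hQ1 (Polynomial.derivative_eq_zero.1 h0)
  have hle := Polynomial.natDegree_le_of_dvd h hd0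
  have hlt : (derivative Q).natDegree < Q.natDegree :=
    Polynomial.natDegree_derivative_lt hQ1
  omega

/-- **The logarithm of an algebraic branch is transcendental — parametrised-zero form.**  See the
module docstring. [folklore (Liouville), made concrete] (new in this form) -/
theorem not_isAlgebraic_log_algebraicBranch_param {z₀ : ℂ} (Q : ℂ[X][X]) (hQirr : Irreducible Q)
    (hQ1 : Q.natDegree ≠ 0) {γ η : ℂ → ℂ} (hγan : AnalyticAt ℂ γ 0) (hηan : AnalyticAt ℂ η 0)
    (hη0 : η 0 = 0) (hγ' : ∀ᶠ t in 𝓝[≠] (0 : ℂ), deriv γ t ≠ 0) (hηne : ¬ ∀ᶠ t in 𝓝 (0 : ℂ), η t = 0)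
    (hQγ : ∀ᶠ t in 𝓝 (0 : ℂ), (Q.map (Polynomial.evalRingHom (γ t))).eval (η t) = 0)
    {ρ L : ℂ → ℂ} (hρan : AnalyticAt ℂ ρ z₀) (hLan : AnalyticAt ℂ L z₀) (hρ0 : ρ z₀ ≠ 0)
    (hQρ : ∀ᶠ z in 𝓝 z₀, (Q.map (Polynomial.evalRingHom z)).eval (ρ z) = 0)
    (hL : ∀ᶠ z in 𝓝 z₀, HasDerivAt L (deriv ρ z / ρ z) z)
    (hLalg : IsAlgebraic (Algebra.adjoin ℂ ({zGerm z₀} : Set (AGerm z₀))) (AGerm.mk z₀ hLan)) :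
    False := by
  classical
  obtain ⟨H, hH0, hH⟩ := exists_polyPoly_relation hLalg
  obtain ⟨F, G, M, hM1, hG0, hR⟩ := exists_logRelation_of_algebraic Q hρan hLan hρ0 hQρ hL hH0 hH
  set R : ℂ[X][X] := G * (Polynomial.X * (coeffDeriv F * derivative Q - derivative F * coeffDeriv Q) -
      Polynomial.C (Polynomial.C (M : ℂ)) * coeffDeriv Q * G) -
    Polynomial.X * (coeffDeriv G * derivative Q - derivative G * coeffDeriv Q) * F with hRdef
  have hQO : germEval₂ z₀ (AGerm.mk z₀ hρan) Q = 0 := (germEval₂_mk_eq_zero_iff hρan Q).2 hQρ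
  have hQR : Q ∣ R := dvd_of_germEval₂_eq_zero _ hQirr hQ1 hQO hR
  have hQG : ¬ Q ∣ G := by
    rintro ⟨S, hS⟩
    apply hG0
    rw [hS, map_mul, hQO, zero_mul]
  -- the functions along the parametrised branch
  have hfan : AnalyticAt ℂ (fun t => (F.map (Polynomial.evalRingHom (γ t))).eval (η t)) 0 :=
    analyticAt_evalPP₂ hγan hηan F
  have hgan : AnalyticAt ℂ (fun t => (G.map (Polynomial.evalRingHom (γ t))).eval (η t)) 0 :=
    analyticAt_evalPP₂ hγan hηan G
  have hg0 : ¬ ∀ᶠ t in 𝓝 (0 : ℂ), (G.map (Polynomial.evalRingHom (γ t))).eval (η t) = 0 := fun h =>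
    hQG ((evalPP₂_eventually_eq_zero_iff_dvd hγan hηan hγ' hQirr hQ1 hQγ G).1 h)
  have hRγ : ∀ᶠ t in 𝓝 (0 : ℂ), (R.map (Polynomial.evalRingHom (γ t))).eval (η t) = 0 :=
    (evalPP₂_eventually_eq_zero_iff_dvd hγan hηan hγ' hQirr hQ1 hQγ R).2 hQR
  have hean : AnalyticAt ℂ (fun t => ((derivative Q).map (Polynomial.evalRingHom (γ t))).eval (η t)) 0 :=
    analyticAt_evalPP₂ hγan hηan _
  have he0 : ¬ ∀ᶠ t in 𝓝 (0 : ℂ), ((derivative Q).map (Polynomial.evalRingHom (γ t))).eval (η t) = 0 :=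
    fun h => not_dvd_derivative_of_natDegree_ne_zero hQ1
      ((evalPP₂_eventually_eq_zero_iff_dvd hγan hηan hγ' hQirr hQ1 hQγ _).1 h)
  have hene : ∀ᶠ t in 𝓝[≠] (0 : ℂ), ((derivative Q).map (Polynomial.evalRingHom (γ t))).eval (η t) ≠ 0 :=
    hean.eventually_eq_zero_or_eventually_ne_zero.resolve_left he0
  have hηne' : ∀ᶠ t in 𝓝[≠] (0 : ℂ), η t ≠ 0 :=
    hηan.eventually_eq_zero_or_eventually_ne_zero.resolve_left hηne
  have hgne : ∀ᶠ t in 𝓝[≠] (0 : ℂ), (G.map (Polynomial.evalRingHom (γ t))).eval (η t) ≠ 0 :=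
    hgan.eventually_eq_zero_or_eventually_ne_zero.resolve_left hg0
  -- the derivative of `f/g` on the punctured neighbourhood is `-M η'/η`
  have hderiv : ∀ᶠ t in 𝓝[≠] (0 : ℂ), HasDerivAt
      (fun s => (F.map (Polynomial.evalRingHom (γ s))).eval (η s) /
        (G.map (Polynomial.evalRingHom (γ s))).eval (η s))
      (-(M : ℂ) * (deriv η t / η t)) t := by
    filter_upwards [hηne', hgne, hene, nhdsWithin_le_nhds hRγ,
      nhdsWithin_le_nhds (eventually_eventually_nhds.2 hQγ),
      nhdsWithin_le_nhds hηan.eventually_analyticAt, nhdsWithin_le_nhds hγan.eventually_analyticAt]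
      with t hηt hgt het hRt hQt hηt_an hγt_an
    have hη' : HasDerivAt η (deriv η t) t := hηt_an.differentiableAt.hasDerivAt
    have hγ'' : HasDerivAt γ (deriv γ t) t := hγt_an.differentiableAt.hasDerivAt
    have hQd := hasDerivAt_evalPP₂ hγ'' hη' Q
    have hQ0 : (fun y => (Q.map (Polynomial.evalRingHom (γ y))).eval (η y)) =ᶠ[𝓝 t] fun _ => (0 : ℂ) :=
      hQt
    have hQs := hQd.unique ((hasDerivAt_const t (0 : ℂ)).congr_of_eventuallyEq hQ0)
    have hF' := hasDerivAt_evalPP₂ hγ'' hη' F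
    have hG' := hasDerivAt_evalPP₂ hγ'' hη' G
    refine (hF'.div hG' hgt).congr_deriv ?_
    simp only [hRdef, Polynomial.map_sub, Polynomial.map_mul, Polynomial.eval_sub, Polynomial.eval_mul,
      Polynomial.map_X, Polynomial.eval_X, Polynomial.map_C, Polynomial.eval_C, Polynomial.coe_evalRingHom]
      at hRt
    set y := η t
    set η' := deriv η t
    set γ' := deriv γ t
    set f := (F.map (Polynomial.evalRingHom (γ t))).eval y
    set g := (G.map (Polynomial.evalRingHom (γ t))).eval y
    set Fs := ((coeffDeriv F).map (Polynomial.evalRingHom (γ t))).eval y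
    set Ft := ((derivative F).map (Polynomial.evalRingHom (γ t))).eval y
    set Gs := ((coeffDeriv G).map (Polynomial.evalRingHom (γ t))).eval y
    set Gt := ((derivative G).map (Polynomial.evalRingHom (γ t))).eval y
    set Qs := ((coeffDeriv Q).map (Polynomial.evalRingHom (γ t))).eval y
    set Qt := ((derivative Q).map (Polynomial.evalRingHom (γ t))).eval y
    have key : y * ((Fs * γ' + Ft * η') * g - f * (Gs * γ' + Gt * η')) + (M : ℂ) * η' * g ^ 2 = 0 := by
      have h1 : Qt * (y * ((Fs * γ' + Ft * η') * g - f * (Gs * γ' + Gt * η')) + (M : ℂ) * η' * g ^ 2) = 0 := by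
        linear_combination γ' * hRt + (y * (Ft * g - f * Gt) + (M : ℂ) * g ^ 2) * hQs
      exact (mul_eq_zero.1 h1).resolve_left het
    field_simp
    linear_combination key
  exact no_quotient_primitive_of_logDeriv hfan hgan hg0 hηan hη0 hηne
    (neg_ne_zero.2 (Nat.cast_ne_zero.2 (by omega))) hderiv

/-- **Parametrised-pole form**: `Q(γ t, 1/η t) = 0` on a punctured neighbourhood, `η(0) = 0`. See the
module docstring. [folklore (Liouville), made concrete] (new in this form) -/
theorem not_isAlgebraic_log_algebraicBranch_param_pole {z₀ : ℂ} (Q : ℂ[X][X])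
    (hQirr : Irreducible Q) (hQ1 : Q.natDegree ≠ 0) (hQ00 : Q.coeff 0 ≠ 0) {γ η : ℂ → ℂ}
    (hγan : AnalyticAt ℂ γ 0) (hηan : AnalyticAt ℂ η 0) (hη0 : η 0 = 0)
    (hγ' : ∀ᶠ t in 𝓝[≠] (0 : ℂ), deriv γ t ≠ 0) (hηne : ¬ ∀ᶠ t in 𝓝 (0 : ℂ), η t = 0)
    (hQγ : ∀ᶠ t in 𝓝[≠] (0 : ℂ), (Q.map (Polynomial.evalRingHom (γ t))).eval (η t)⁻¹ = 0)
    {ρ L : ℂ → ℂ} (hρan : AnalyticAt ℂ ρ z₀) (hLan : AnalyticAt ℂ L z₀) (hρ0 : ρ z₀ ≠ 0)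
    (hQρ : ∀ᶠ z in 𝓝 z₀, (Q.map (Polynomial.evalRingHom z)).eval (ρ z) = 0)
    (hL : ∀ᶠ z in 𝓝 z₀, HasDerivAt L (deriv ρ z / ρ z) z)
    (hLalg : IsAlgebraic (Algebra.adjoin ℂ ({zGerm z₀} : Set (AGerm z₀))) (AGerm.mk z₀ hLan)) :
    False := by
  classical
  have hN : Q.reverse.natDegree = Q.natDegree := by
    rw [Polynomial.reverse_natDegree, Polynomial.natTrailingDegree_eq_zero_of_constantCoeff_ne_zero hQ00,
      Nat.sub_zero]
  have hirr' : Irreducible Q.reverse := irreducible_reverse hQirr hQ00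
  -- `Q^rev(γ t, η t) = 0` on the punctured neighbourhood, hence near `0` (continuity at `t = 0`)
  have hηne' : ∀ᶠ t in 𝓝[≠] (0 : ℂ), η t ≠ 0 :=
    hηan.eventually_eq_zero_or_eventually_ne_zero.resolve_left hηne
  have hrevp : ∀ᶠ t in 𝓝[≠] (0 : ℂ), (Q.reverse.map (Polynomial.evalRingHom (γ t))).eval (η t) = 0 := by
    filter_upwards [hQγ, hηne'] with t ht hηt
    haveI := invertibleOfNonzero (inv_ne_zero hηt)
    have h := Polynomial.eval₂_reverse_mul_pow (Polynomial.evalRingHom (γ t)) (η t)⁻¹ Q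
    rw [Polynomial.eval_map] at ht ⊢
    rw [invOf_eq_inv, inv_inv, ht, mul_eq_zero] at h
    exact h.resolve_right (pow_ne_zero _ (inv_ne_zero hηt))
  have hrev0 : ∀ᶠ t in 𝓝 (0 : ℂ), (Q.reverse.map (Polynomial.evalRingHom (γ t))).eval (η t) = 0 := by
    have hcont := (analyticAt_evalPP₂ hγan hηan Q.reverse).continuousAt
    have hat : (Q.reverse.map (Polynomial.evalRingHom (γ 0))).eval (η 0) = 0 :=
      eq_at_of_eventuallyEq_punctured (F := fun t => (Q.reverse.map (Polynomial.evalRingHom (γ t))).eval (η t))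
        (G := fun _ => (0 : ℂ)) hcont continuousAt_const hrevp
    have h' : ∀ᶠ t in 𝓝[≠] (0 : ℂ), t ∈ {t | (Q.reverse.map (Polynomial.evalRingHom (γ t))).eval (η t) = 0} :=
      hrevp
    rw [eventually_nhdsWithin_iff] at h'
    filter_upwards [h'] with t ht
    by_cases h0 : t = 0
    · rw [h0]; exact hat
    · exact ht h0
  -- the branch `1/ρ` and `-L`
  have hρne : ∀ᶠ z in 𝓝 z₀, ρ z ≠ 0 := hρan.continuousAt.eventually_ne hρ0
  have hρ'an : AnalyticAt ℂ (fun z => (ρ z)⁻¹) z₀ := hρan.inv hρ0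
  have hQ'ρ : ∀ᶠ z in 𝓝 z₀, (Q.reverse.map (Polynomial.evalRingHom z)).eval ((ρ z)⁻¹) = 0 := by
    filter_upwards [hQρ, hρne] with z hz hρz
    haveI := invertibleOfNonzero hρz
    have h := Polynomial.eval₂_reverse_mul_pow (Polynomial.evalRingHom z) (ρ z) Q
    rw [Polynomial.eval_map] at hz ⊢
    rw [hz, mul_eq_zero, invOf_eq_inv] at h
    exact h.resolve_right (pow_ne_zero _ hρz)
  have hL' : ∀ᶠ z in 𝓝 z₀, HasDerivAt (fun w => -L w) (deriv (fun w => (ρ w)⁻¹) z / (ρ z)⁻¹) z := by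
    filter_upwards [hL, hρne, hρan.eventually_analyticAt] with z hLz hρz hρaz
    have hinv : HasDerivAt (fun w => (ρ w)⁻¹) (-(deriv ρ z) / (ρ z) ^ 2) z :=
      (hρaz.differentiableAt.hasDerivAt).inv hρz
    have hval : -(deriv ρ z) / ρ z ^ 2 / (ρ z)⁻¹ = -(deriv ρ z / ρ z) := by
      rw [div_inv_eq_mul]
      field_simp
    rw [hinv.deriv, hval]
    exact hLz.neg
  have hLalg' : IsAlgebraic (Algebra.adjoin ℂ ({zGerm z₀} : Set (AGerm z₀))) (AGerm.mk z₀ hLan.neg) := by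
    rw [AGerm.mk_neg]; exact hLalg.neg
  exact not_isAlgebraic_log_algebraicBranch_param Q.reverse hirr' (by rw [hN]; exact hQ1) hγan hηan hη0 hγ'
    hηne hrev0 hρ'an hLan.neg (inv_ne_zero hρ0) hQ'ρ hL' hLalg'

end Summit.Schanuel.Schanuel.Theorems
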